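import Summits.HodgeConjecture.CorCM.Census.QuaternionColumnCoincidence

/-!
# The quaternion column, VIII-a: the two halves of a type, the normal form of one-arc types, the halves of the near types

COR-CM (cell `pub-hodgecm2`), count-neutral kernel combinatorics by the binder seat b09 (gen 39; lane QUATERNION COLUMN), part VIII-a, on
parts I–VI (`Census/QuaternionColumn*.lean`: `barc`, `arcZ`, `rt_a_barc`, `rt_xa_barc`, `val_sub_lt_iff_reflect`, `bpot_C`, …) used BY
NAME.  Two bookkeeping definitions with bodies (`aPart`, `xPart`: the rotation and reflection halves of a type, as subsets of `ℤ/2n`) +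
theorems; no `decide`, no certificate, no named fact, no `sorry`.
HONEST FRAMING: `HC_CM` is NOT proved, here or anywhere in the tree; nothing here is a period or a headline.

WHY.  The fibre-independence of the explicit family `qfam` (part V) is a pivot argument on block parities; it needs the blocks met by the
family near `T₀ = barc 0 0` to be DISTINCT: the single-flip blocks `blk U_i` (`U_i = T₀^{(a i)}`), `blk V_j` (`V_j = T₀^{(xa j)}`), the
coincidence blocks `blk C_i`, `blk C'_j`, and the biarc blocks.  The tool is the NORMAL FORM of a one-arc type:
* §1 the halves `aPart Ψ = {i : a i ∈ Ψ}`, `xPart Ψ = {j : xa j ∈ Ψ}` and their transport: `aPart (Ψ·(a k)⁻¹) = aPart Ψ − k`,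
  `xPart (Ψ·(a k)⁻¹) = xPart Ψ − k`, `aPart (Ψ·(xa k)⁻¹) = k − xPart Ψ`, `xPart (Ψ·(xa k)⁻¹) = n + k − aPart Ψ`;
* §2 arcs are carried to arcs by shifts and reflections, and `arcZ` is injective; hence (§3, `eq_one_of_xPart`) **a type whose reflection half
  is the standard arc `arcZ 0` and whose rotation half is NOT an arc has trivial transporter onto any type with the same reflection half** (and
  symmetrically);
* §4 the halves of `U_i, V_j, C_i, C'_j` and their non-arc-ness (no arc has a hole), whence the DISTINCTNESS theorems
  (`blk_U_inj`, `blk_V_inj`, `blk_U_ne_V`, `blk_C_inj`, `blk_C'_inj`, `blk_C_ne_C'`, `…_ne_barc`).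

## References
* [Pohlmann1968] H. Pohlmann, Algebraic cycles on abelian varieties of complex multiplication type, Ann. of Math. 88 (1968), Thm 1.
-/

namespace Summit.HodgeConjecture.CorCM.Census.QuaternionColumn

open Finset QuaternionGroup
open Summit.HodgeConjecture.CorCM.Prior.AllgGroup.RfwfAllgGroup
open Summit.HodgeConjecture.CorCM.Census.BlockParity
open Summit.HodgeConjecture.CorCM.Census.BaseBlock
open Summit.HodgeConjecture.CorCM.Census.TwistGeneration

noncomputable section

variable {n : ℕ} [NeZero n]

/-! ## §1 The two halves of a type and their transport -/

/-- The rotation half `{i : a i ∈ Ψ}`. [folklore] -/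
def aPart (Ψ : CMF (QuaternionGroup n) (c n)) : Finset (ZMod (2 * n)) := univ.filter fun i => (a i : QuaternionGroup n) ∈ Ψ.1

/-- The reflection half `{j : xa j ∈ Ψ}`. [folklore] -/
def xPart (Ψ : CMF (QuaternionGroup n) (c n)) : Finset (ZMod (2 * n)) := univ.filter fun j => (xa j : QuaternionGroup n) ∈ Ψ.1

/-- Membership in the rotation half. [folklore] -/
@[simp] theorem mem_aPart (Ψ : CMF (QuaternionGroup n) (c n)) (i : ZMod (2 * n)) : i ∈ aPart Ψ ↔ (a i : QuaternionGroup n) ∈ Ψ.1 := by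
  simp [aPart]

/-- Membership in the reflection half. [folklore] -/
@[simp] theorem mem_xPart (Ψ : CMF (QuaternionGroup n) (c n)) (j : ZMod (2 * n)) : j ∈ xPart Ψ ↔ (xa j : QuaternionGroup n) ∈ Ψ.1 := by
  simp [xPart]

/-- The halves of a biarc are arcs. [folklore] -/
theorem parts_barc (p q : ZMod (2 * n)) : aPart (barc p q) = arcZ p ∧ xPart (barc p q) = arcZ q := by
  constructor
  · ext i; rw [mem_aPart, a_mem_barc, mem_arcZ]
  · ext j; rw [mem_xPart, xa_mem_barc, mem_arcZ]

/-- Transport of the halves along a rotation. [folklore] -/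
theorem parts_rt_a (k : ZMod (2 * n)) (Ψ : CMF (QuaternionGroup n) (c n)) :
    aPart (rt (c n) (a k) Ψ) = (aPart Ψ).image (fun i => i - k) ∧ xPart (rt (c n) (a k) Ψ) = (xPart Ψ).image (fun j => j - k) := by
  constructor
  · ext i
    rw [mem_aPart, mem_rt, a_mul_a, mem_image]
    constructor
    · intro h; exact ⟨i + k, (mem_aPart _ _).mpr h, by ring⟩
    · rintro ⟨i', hi', rfl⟩; rw [sub_add_cancel]; exact (mem_aPart _ _).mp hi'
  · ext j
    rw [mem_xPart, mem_rt, xa_mul_a, mem_image]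
    constructor
    · intro h; exact ⟨j + k, (mem_xPart _ _).mpr h, by ring⟩
    · rintro ⟨j', hj', rfl⟩; rw [sub_add_cancel]; exact (mem_xPart _ _).mp hj'

/-- Transport of the halves along a reflection (the halves swap). [folklore] -/
theorem parts_rt_xa (k : ZMod (2 * n)) (Ψ : CMF (QuaternionGroup n) (c n)) :
    aPart (rt (c n) (xa k) Ψ) = (xPart Ψ).image (fun j => k - j) ∧
      xPart (rt (c n) (xa k) Ψ) = (aPart Ψ).image (fun i => (n : ZMod (2 * n)) + k - i) := by
  constructor
  · ext i
    rw [mem_aPart, mem_rt, a_mul_xa, mem_image]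
    constructor
    · intro h; exact ⟨k - i, (mem_xPart _ _).mpr h, by ring⟩
    · rintro ⟨j, hj, rfl⟩; rw [show k - (k - j) = j by ring]; exact (mem_xPart _ _).mp hj
  · ext j
    rw [mem_xPart, mem_rt, xa_mul_xa, mem_image]
    constructor
    · intro h; exact ⟨(n : ZMod (2 * n)) + k - j, (mem_aPart _ _).mpr h, by ring⟩
    · rintro ⟨i, hi, rfl⟩; rw [show (n : ZMod (2 * n)) + k - ((n : ZMod (2 * n)) + k - i) = i by ring]; exact (mem_aPart _ _).mp hi

/-- Flipping at a rotation place changes the rotation half by the pair `{t, t+n}` and leaves the reflection half. [folklore] -/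
theorem parts_oflipCM_a (t : ZMod (2 * n)) (Ψ : CMF (QuaternionGroup n) (c n)) :
    xPart (oflipCM (c n) c_mul_c (a t) Ψ) = xPart Ψ ∧
      ∀ i, i ∈ aPart (oflipCM (c n) c_mul_c (a t) Ψ) ↔ ¬ (i ∈ aPart Ψ ↔ (i = t ∨ i = t + (n : ZMod (2 * n)))) := by
  constructor
  · ext j; rw [mem_xPart, mem_xPart, mem_oflipCM_of_notMem_orb (by rw [mem_orb, (c_mul_a t).1]; rintro (h | h) <;> cases h)]
  · intro i
    rw [mem_aPart, mem_aPart, mem_oflipCM_iff' c_mul_c, mem_orb, (c_mul_a t).1]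
    have h1 : (a i : QuaternionGroup n) = a t ↔ i = t := ⟨fun h => QuaternionGroup.a.inj h, fun h => by rw [h]⟩
    have h2 : (a i : QuaternionGroup n) = a (t + (n : ZMod (2 * n))) ↔ i = t + (n : ZMod (2 * n)) :=
      ⟨fun h => QuaternionGroup.a.inj h, fun h => by rw [h]⟩
    rw [h1, h2]

/-- Flipping at a reflection place changes the reflection half and leaves the rotation half. [folklore] -/
theorem parts_oflipCM_xa (t : ZMod (2 * n)) (Ψ : CMF (QuaternionGroup n) (c n)) :
    aPart (oflipCM (c n) c_mul_c (xa t) Ψ) = aPart Ψ ∧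
      ∀ j, j ∈ xPart (oflipCM (c n) c_mul_c (xa t) Ψ) ↔ ¬ (j ∈ xPart Ψ ↔ (j = t ∨ j = t + (n : ZMod (2 * n)))) := by
  constructor
  · ext i; rw [mem_aPart, mem_aPart, mem_oflipCM_of_notMem_orb (a_notMem_orb_xa _ _)]
  · intro j
    rw [mem_xPart, mem_xPart, mem_oflipCM_iff' c_mul_c, mem_orb, (c_mul_a t).2]
    have h1 : (xa j : QuaternionGroup n) = xa t ↔ j = t := ⟨fun h => QuaternionGroup.xa.inj h, fun h => by rw [h]⟩
    have h2 : (xa j : QuaternionGroup n) = xa (t + (n : ZMod (2 * n))) ↔ j = t + (n : ZMod (2 * n)) :=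
      ⟨fun h => QuaternionGroup.xa.inj h, fun h => by rw [h]⟩
    rw [h1, h2]

/-! ## §2 Arcs under shifts and reflections -/

/-- A shifted arc is an arc: `(arcZ p) − k = arcZ (p − k)`. [folklore] -/
theorem image_sub_arcZ (p k : ZMod (2 * n)) : (arcZ p).image (fun i => i - k) = arcZ (p - k) := by
  ext i
  rw [mem_image, mem_arcZ]
  constructor
  · rintro ⟨i', hi', rfl⟩; rw [mem_arcZ] at hi'; rwa [show i' - k - (p - k) = i' - p by ring]
  · intro h; exact ⟨i + k, by rw [mem_arcZ, show i + k - p = i - (p - k) by ring]; exact h, by ring⟩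

/-- A reflected arc is an arc: `m − arcZ p = arcZ (m − p + n + 1)`. [folklore] -/
theorem image_reflect_arcZ (p m : ZMod (2 * n)) :
    (arcZ p).image (fun i => m - i) = arcZ (m - p + (n : ZMod (2 * n)) + 1) := by
  ext i
  rw [mem_image, mem_arcZ]
  constructor
  · rintro ⟨i', hi', rfl⟩
    rw [mem_arcZ] at hi'
    exact (val_sub_lt_iff_reflect m (m - i') p).mp (by rwa [show m - (m - i') - p = i' - p by ring])
  · intro h
    refine ⟨m - i, ?_, by ring⟩
    rw [mem_arcZ]
    exact (val_sub_lt_iff_reflect m i p).mpr h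

/-- **`arcZ` is injective.** [folklore] -/
theorem arcZ_inj {p p' : ZMod (2 * n)} (h : arcZ p = arcZ p') : p = p' := by
  have hn := NeZero.ne n
  have h1 : p ∈ arcZ p' := by rw [← h, mem_arcZ, sub_self, ZMod.val_zero]; omega
  have h2 : p' ∈ arcZ p := by rw [h, mem_arcZ, sub_self, ZMod.val_zero]; omega
  rw [mem_arcZ] at h1 h2
  by_contra hne
  have hne' : p - p' ≠ 0 := sub_ne_zero.mpr hne
  have e : p' - p = -(p - p') := by ring
  rw [e, ZMod.neg_val, if_neg hne'] at h2
  have := ZMod.val_lt (p - p')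
  omega

/-- Shifts reflect non-arcs: if `S − k` is an arc then `S` is an arc. [folklore] -/
theorem isArc_of_image_sub {S : Finset (ZMod (2 * n))} {k q : ZMod (2 * n)} (h : S.image (fun i => i - k) = arcZ q) : S = arcZ (q + k) := by
  have e : S = (S.image (fun i => i - k)).image (fun i => i - (-k)) := by
    rw [image_image]; conv_lhs => rw [← image_id (s := S)]
    congr 1; funext i; simp
  rw [e, h, image_sub_arcZ, sub_neg_eq_add]

/-- Reflections reflect non-arcs: if `m − S` is an arc then `S` is an arc. [folklore] -/
theorem isArc_of_image_reflect {S : Finset (ZMod (2 * n))} {m q : ZMod (2 * n)} (h : S.image (fun i => m - i) = arcZ q) :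
    S = arcZ (m - q + (n : ZMod (2 * n)) + 1) := by
  have e : S = (S.image (fun i => m - i)).image (fun i => m - i) := by
    rw [image_image]; conv_lhs => rw [← image_id (s := S)]
    congr 1; funext i; simp
  rw [e, h, image_reflect_arcZ]

/-! ## §3 The normal form: trivial transporters of one-arc types -/

/-- **Trivial transporter, reflection half standard**: if `xPart Ψ = arcZ 0`, `aPart Ψ` is not an arc, and `xPart (Ψ·Q⁻¹) = arcZ 0`, then
`Q = 1`. [folklore] -/
theorem eq_one_of_xPart {Ψ : CMF (QuaternionGroup n) (c n)} (hx : xPart Ψ = arcZ 0) (ha : ∀ p, aPart Ψ ≠ arcZ p) {Q : QuaternionGroup n}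
    (hQ : xPart (rt (c n) Q Ψ) = arcZ 0) : Q = 1 := by
  cases Q with
  | a k =>
    rw [(parts_rt_a k Ψ).2, hx, image_sub_arcZ, zero_sub] at hQ
    have hk : -k = 0 := arcZ_inj hQ
    rw [neg_eq_zero.mp hk, one_def]
  | xa k =>
    rw [(parts_rt_xa k Ψ).2] at hQ
    exact absurd (isArc_of_image_reflect hQ) (ha _)

/-- **Trivial transporter, rotation half standard**: if `aPart Ψ = arcZ 0`, `xPart Ψ` is not an arc, and `aPart (Ψ·Q⁻¹) = arcZ 0`, then
`Q = 1`. [folklore] -/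
theorem eq_one_of_aPart {Ψ : CMF (QuaternionGroup n) (c n)} (ha : aPart Ψ = arcZ 0) (hx : ∀ p, xPart Ψ ≠ arcZ p) {Q : QuaternionGroup n}
    (hQ : aPart (rt (c n) Q Ψ) = arcZ 0) : Q = 1 := by
  cases Q with
  | a k =>
    rw [(parts_rt_a k Ψ).1, ha, image_sub_arcZ, zero_sub] at hQ
    have hk : -k = 0 := arcZ_inj hQ
    rw [neg_eq_zero.mp hk, one_def]
  | xa k =>
    rw [(parts_rt_xa k Ψ).1] at hQ
    exact absurd (isArc_of_image_reflect hQ) (hx _)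

/-- Two types are equal iff their halves are. [folklore] -/
theorem eq_of_parts {Φ Ψ : CMF (QuaternionGroup n) (c n)} (ha : aPart Φ = aPart Ψ) (hx : xPart Φ = xPart Ψ) : Φ = Ψ :=
  ext_of_a_xa (fun i => by rw [← mem_aPart, ← mem_aPart, ha]) (fun j => by rw [← mem_xPart, ← mem_xPart, hx])

/-- **No arc has a hole**: `v ∈ arcZ p`, `v + 1 ∉ arcZ p`, `v + 2 ∈ arcZ p` is impossible (`n ≥ 2`). [folklore] -/
theorem not_sandwich_arcZ (h2 : 2 ≤ n) (p v : ZMod (2 * n)) (hv : v ∈ arcZ p) (hv1 : v + 1 ∉ arcZ p) : v + 2 ∉ arcZ p := by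
  rw [← (parts_barc p 0).1, mem_aPart] at hv hv1 ⊢
  exact not_sandwich_a h2 p 0 v hv hv1

/-- A set with a hole `v ∈ S, v+1 ∉ S, v+2 ∈ S` is not an arc. [folklore] -/
theorem ne_arcZ_of_hole (h2 : 2 ≤ n) {S : Finset (ZMod (2 * n))} {v : ZMod (2 * n)} (hv : v ∈ S) (hv1 : v + 1 ∉ S) (hv2 : v + 2 ∈ S)
    (p : ZMod (2 * n)) : S ≠ arcZ p := by
  intro h; rw [h] at hv hv1 hv2; exact not_sandwich_arcZ h2 p v hv hv1 hv2

/-! ## §4 The halves of the near types and the distinctness of their blocks -/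

/-- Base-point facts in `ℤ/2n` for a natural `k < n`: `(k : ℤ/2n) ∈ arcZ 0`, `k + n ∉ arcZ 0`. [folklore] -/
theorem natCast_mem_arcZ_zero {k : ℕ} (hk : k < n) :
    ((k : ℕ) : ZMod (2 * n)) ∈ arcZ 0 ∧ ((k : ℕ) : ZMod (2 * n)) + (n : ZMod (2 * n)) ∉ arcZ 0 := by
  rw [mem_arcZ, mem_arcZ, sub_zero, sub_zero, val_natCast_of_lt (by omega), ← Nat.cast_add, val_natCast_of_lt (by omega)]
  omega

/-- **The halves of `U_i = T₀^{(a i)}`**: `xPart = arcZ 0`; `aPart` contains `i−1`, `i+1`… precisely: membership in `aPart U_i` is membership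
in `arcZ 0` flipped exactly at `i` and `i+n`. [folklore] -/
theorem parts_U (i : ZMod (2 * n)) :
    xPart (oflipCM (c n) c_mul_c (a i) (barc (0 : ZMod (2 * n)) 0)) = arcZ 0 ∧
      ∀ v, v ∈ aPart (oflipCM (c n) c_mul_c (a i) (barc (0 : ZMod (2 * n)) 0)) ↔ ¬ (v ∈ arcZ 0 ↔ (v = i ∨ v = i + (n : ZMod (2 * n)))) := by
  refine ⟨by rw [(parts_oflipCM_a i _).1, (parts_barc 0 0).2], fun v => ?_⟩
  rw [(parts_oflipCM_a i _).2, (parts_barc 0 0).1]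

/-- **The halves of `V_j = T₀^{(xa j)}`**. [folklore] -/
theorem parts_V (j : ZMod (2 * n)) :
    aPart (oflipCM (c n) c_mul_c (xa j) (barc (0 : ZMod (2 * n)) 0)) = arcZ 0 ∧
      ∀ v, v ∈ xPart (oflipCM (c n) c_mul_c (xa j) (barc (0 : ZMod (2 * n)) 0)) ↔ ¬ (v ∈ arcZ 0 ↔ (v = j ∨ v = j + (n : ZMod (2 * n)))) := by
  refine ⟨by rw [(parts_oflipCM_xa j _).1, (parts_barc 0 0).1], fun v => ?_⟩
  rw [(parts_oflipCM_xa j _).2, (parts_barc 0 0).2]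

/-- **The halves of `C_i = T₀^{(a 0)(a (i+1))}`**: `xPart = arcZ 0`, `aPart` = `arcZ 0` flipped at `0, n` and at `i+1, i+1+n`. [folklore] -/
theorem parts_C (i : ZMod (2 * n)) :
    xPart (oflipCM (c n) c_mul_c (a 0) (oflipCM (c n) c_mul_c (a (i + 1)) (barc (0 : ZMod (2 * n)) 0))) = arcZ 0 ∧
      ∀ v, v ∈ aPart (oflipCM (c n) c_mul_c (a 0) (oflipCM (c n) c_mul_c (a (i + 1)) (barc (0 : ZMod (2 * n)) 0))) ↔
        ¬ (¬ (v ∈ arcZ 0 ↔ (v = i + 1 ∨ v = i + 1 + (n : ZMod (2 * n)))) ↔ (v = 0 ∨ v = 0 + (n : ZMod (2 * n)))) := by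
  refine ⟨by rw [(parts_oflipCM_a 0 _).1, (parts_oflipCM_a (i + 1) _).1, (parts_barc 0 0).2], fun v => ?_⟩
  rw [(parts_oflipCM_a 0 _).2, (parts_oflipCM_a (i + 1) _).2, (parts_barc 0 0).1]

/-- **The halves of `C'_j = T₀^{(a 0)(xa (j+1))}`**: `aPart = arcZ 0` flipped at `0, n` (i.e. `arcZ 1`), `xPart = arcZ 0` flipped at `j+1`. [folklore] -/
theorem parts_C' (j : ZMod (2 * n)) :
    (∀ v, v ∈ aPart (oflipCM (c n) c_mul_c (a 0) (oflipCM (c n) c_mul_c (xa (j + 1)) (barc (0 : ZMod (2 * n)) 0))) ↔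
        ¬ (v ∈ arcZ 0 ↔ (v = 0 ∨ v = 0 + (n : ZMod (2 * n))))) ∧
      ∀ v, v ∈ xPart (oflipCM (c n) c_mul_c (a 0) (oflipCM (c n) c_mul_c (xa (j + 1)) (barc (0 : ZMod (2 * n)) 0))) ↔
        ¬ (v ∈ arcZ 0 ↔ (v = j + 1 ∨ v = j + 1 + (n : ZMod (2 * n)))) := by
  refine ⟨fun v => ?_, fun v => ?_⟩
  · rw [(parts_oflipCM_a 0 _).2, (parts_oflipCM_xa (j + 1) _).1, (parts_barc 0 0).1]
  · rw [(parts_oflipCM_a 0 _).1, (parts_oflipCM_xa (j + 1) _).2, (parts_barc 0 0).2]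

/-- `arcZ 0` flipped at `0` and `n` is `arcZ 1`. [folklore] -/
theorem mem_arcZ_one_iff (v : ZMod (2 * n)) : v ∈ arcZ (1 : ZMod (2 * n)) ↔ ¬ (v ∈ arcZ 0 ↔ (v = 0 ∨ v = 0 + (n : ZMod (2 * n)))) := by
  rw [mem_arcZ, mem_arcZ, show (1 : ZMod (2 * n)) = 0 + 1 by ring, mem_arc_succ_iff]
  exact (flip_iff_helper (fun h => by rw [h]; exact (val_self_sub_lt 0).1) (fun h => by rw [h]; exact (val_self_sub_lt 0).2)).symm

/-- The arc `arcZ 0` has a "hole pattern" around an interior natural `k`: `k−1 ∈`, `k ∈`, `k+1 ∈` for `1 ≤ k ≤ n−2`. Stated as the memberships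
we need, for naturals below `n`. [folklore] -/
theorem natCast_mem_arcZ_zero_iff (k : ℕ) (hk : k < 2 * n) : ((k : ℕ) : ZMod (2 * n)) ∈ arcZ 0 ↔ k < n := by
  rw [mem_arcZ, sub_zero, val_natCast_of_lt hk]

omit [NeZero n] in
/-- Equality of small naturals in `ℤ/2n`. [folklore] -/
theorem natCast_eq_natCast_iff' {k m : ℕ} (hk : k < 2 * n) (hm : m < 2 * n) : ((k : ℕ) : ZMod (2 * n)) = (m : ℕ) ↔ k = m :=
  ⟨fun h => by have h' := congrArg ZMod.val h; rwa [ZMod.val_cast_of_lt hk, ZMod.val_cast_of_lt hm] at h', fun h => by rw [h]⟩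

/-- **Membership of a natural `k < 2n` in `aPart U_i`** (`i < n`): `k ≠ i` below `n`, or `k = i + n` above. [folklore] -/
theorem natCast_mem_aPart_U {i k : ℕ} {v : ZMod (2 * n)} (hv : v = (k : ℕ)) (hi : i < n) (hk : k < 2 * n) :
    v ∈ aPart (oflipCM (c n) c_mul_c (a (i : ZMod (2 * n))) (barc (0 : ZMod (2 * n)) 0)) ↔ (k < n ∧ k ≠ i) ∨ k = i + n := by
  subst hv
  rw [(parts_U (n := n) (i : ZMod (2 * n))).2, natCast_mem_arcZ_zero_iff k hk, ← Nat.cast_add, natCast_eq_natCast_iff' hk (by omega),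
    natCast_eq_natCast_iff' hk (by omega)]
  omega

/-- **Membership of a natural `k < 2n` in `xPart V_j`** (`j < n`). [folklore] -/
theorem natCast_mem_xPart_V {j k : ℕ} {v : ZMod (2 * n)} (hv : v = (k : ℕ)) (hj : j < n) (hk : k < 2 * n) :
    v ∈ xPart (oflipCM (c n) c_mul_c (xa (j : ZMod (2 * n))) (barc (0 : ZMod (2 * n)) 0)) ↔ (k < n ∧ k ≠ j) ∨ k = j + n := by
  subst hv
  rw [(parts_V (n := n) (j : ZMod (2 * n))).2, natCast_mem_arcZ_zero_iff k hk, ← Nat.cast_add, natCast_eq_natCast_iff' hk (by omega),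
    natCast_eq_natCast_iff' hk (by omega)]
  omega

/-- **Membership of a natural `k < 2n` in `aPart C_i`** (`i + 1 < n`): `1 ≤ k ≤ n` with `k ≠ i+1`, or `k = i+1+n`. [folklore] -/
theorem natCast_mem_aPart_C {i k : ℕ} {v : ZMod (2 * n)} (hv : v = (k : ℕ)) (hi : i + 1 < n) (hk : k < 2 * n) :
    v ∈ aPart (oflipCM (c n) c_mul_c (a 0) (oflipCM (c n) c_mul_c (a ((i : ZMod (2 * n)) + 1)) (barc (0 : ZMod (2 * n)) 0))) ↔
      (1 ≤ k ∧ k ≤ n ∧ k ≠ i + 1) ∨ k = i + 1 + n := by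
  subst hv
  rw [(parts_C (n := n) (i : ZMod (2 * n))).2, natCast_mem_arcZ_zero_iff k hk, ← Nat.cast_succ, ← Nat.cast_add,
    natCast_eq_natCast_iff' hk (by omega), natCast_eq_natCast_iff' hk (by omega), ← Nat.cast_zero, ← Nat.cast_add,
    natCast_eq_natCast_iff' hk (by omega), natCast_eq_natCast_iff' hk (by omega)]
  omega

/-- **Membership of a natural `k < 2n` in `xPart C'_j`** (`j + 1 < n`): as for `V_{j+1}`. [folklore] -/
theorem natCast_mem_xPart_C' {j k : ℕ} {v : ZMod (2 * n)} (hv : v = (k : ℕ)) (hj : j + 1 < n) (hk : k < 2 * n) :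
    v ∈ xPart (oflipCM (c n) c_mul_c (a 0) (oflipCM (c n) c_mul_c (xa ((j : ZMod (2 * n)) + 1)) (barc (0 : ZMod (2 * n)) 0))) ↔
      (k < n ∧ k ≠ j + 1) ∨ k = j + 1 + n := by
  subst hv
  rw [(parts_C' (n := n) (j : ZMod (2 * n))).2, natCast_mem_arcZ_zero_iff k hk, ← Nat.cast_succ, ← Nat.cast_add,
    natCast_eq_natCast_iff' hk (by omega), natCast_eq_natCast_iff' hk (by omega)]
  omega

/-- **`aPart U_i` is not an arc** (`1 ≤ i ≤ n−2`): it has the hole `i−1 ∈, i ∉, i+1 ∈`. [folklore] -/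
theorem aPart_U_ne_arcZ (i : ℕ) (h1 : 1 ≤ i) (h2 : i + 2 ≤ n) (p : ZMod (2 * n)) :
    aPart (oflipCM (c n) c_mul_c (a (i : ZMod (2 * n))) (barc (0 : ZMod (2 * n)) 0)) ≠ arcZ p := by
  refine ne_arcZ_of_hole (by omega) (v := ((i - 1 : ℕ) : ZMod (2 * n))) ?_ ?_ ?_ p
  · rw [natCast_mem_aPart_U rfl (by omega) (by omega)]; omega
  · rw [natCast_mem_aPart_U (k := i) (by rw [← Nat.cast_succ]; congr 1; omega) (by omega) (by omega)]; omega
  · rw [natCast_mem_aPart_U (k := i + 1) (by push_cast; rw [Nat.cast_sub h1]; push_cast; ring) (by omega) (by omega)]; omega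

/-- The standard halves of the near types: `xPart U_i = xPart C_i = arcZ 0`, `aPart V_j = arcZ 0`, `aPart C'_j = arcZ 1`. [folklore] -/
theorem aPart_C' (j : ZMod (2 * n)) :
    aPart (oflipCM (c n) c_mul_c (a 0) (oflipCM (c n) c_mul_c (xa (j + 1)) (barc (0 : ZMod (2 * n)) 0))) = arcZ 1 := by
  ext v; rw [(parts_C' j).1, mem_arcZ_one_iff]

/-- **`aPart C_i` is not an arc** (`1 ≤ i`, `i + 2 ≤ n`): hole at `i, i+1, i+2`. [folklore] -/
theorem aPart_C_ne_arcZ (i : ℕ) (h1 : 1 ≤ i) (h2 : i + 2 ≤ n) (p : ZMod (2 * n)) :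
    aPart (oflipCM (c n) c_mul_c (a 0) (oflipCM (c n) c_mul_c (a ((i : ZMod (2 * n)) + 1)) (barc (0 : ZMod (2 * n)) 0))) ≠ arcZ p := by
  refine ne_arcZ_of_hole (by omega) (v := ((i : ℕ) : ZMod (2 * n))) ?_ ?_ ?_ p
  · rw [natCast_mem_aPart_C rfl (by omega) (by omega)]; omega
  · rw [natCast_mem_aPart_C (k := i + 1) (by push_cast; ring) (by omega) (by omega)]; omega
  · rw [natCast_mem_aPart_C (k := i + 2) (by push_cast; ring) (by omega) (by omega)]; omega

/-- **`xPart V_j` is not an arc** (`1 ≤ j`, `j + 2 ≤ n`). [folklore] -/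
theorem xPart_V_ne_arcZ (j : ℕ) (h1 : 1 ≤ j) (h2 : j + 2 ≤ n) (p : ZMod (2 * n)) :
    xPart (oflipCM (c n) c_mul_c (xa (j : ZMod (2 * n))) (barc (0 : ZMod (2 * n)) 0)) ≠ arcZ p := by
  refine ne_arcZ_of_hole (by omega) (v := ((j - 1 : ℕ) : ZMod (2 * n))) ?_ ?_ ?_ p
  · rw [natCast_mem_xPart_V rfl (by omega) (by omega)]; omega
  · rw [natCast_mem_xPart_V (k := j) (by rw [← Nat.cast_succ]; congr 1; omega) (by omega) (by omega)]; omega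
  · rw [natCast_mem_xPart_V (k := j + 1) (by push_cast; rw [Nat.cast_sub h1]; push_cast; ring) (by omega) (by omega)]; omega

/-- **`xPart C'_j` is not an arc** (`1 ≤ j`, `j + 3 ≤ n`). [folklore] -/
theorem xPart_C'_ne_arcZ (j : ℕ) (h1 : 1 ≤ j) (h3 : j + 3 ≤ n) (p : ZMod (2 * n)) :
    xPart (oflipCM (c n) c_mul_c (a 0) (oflipCM (c n) c_mul_c (xa ((j : ZMod (2 * n)) + 1)) (barc (0 : ZMod (2 * n)) 0))) ≠ arcZ p := by
  refine ne_arcZ_of_hole (by omega) (v := ((j : ℕ) : ZMod (2 * n))) ?_ ?_ ?_ p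
  · rw [natCast_mem_xPart_C' rfl (by omega) (by omega)]; omega
  · rw [natCast_mem_xPart_C' (k := j + 1) (by push_cast; ring) (by omega) (by omega)]; omega
  · rw [natCast_mem_xPart_C' (k := j + 2) (by push_cast; ring) (by omega) (by omega)]; omega

end

end Summit.HodgeConjecture.CorCM.Census.QuaternionColumn
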